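import Summits.AtomisticToContinuum.FouriersLaw.Theses.StaticAbelianSqueeze
import Summits.AtomisticToContinuum.FouriersLaw.Theses.EmbeddedDrudeMourre
import HarnessLib

/-!
# (R) from halving quasi-additivity of the Abel deficit — composition B of line `Sketch`
(crux `StaticAbelianSqueeze.UniformAbelianRegularity` = (R), item stmt-AtomisticToContinuum-13416; `--supports` file proving the registered
glue stub `stub_regularityOfQuasiAdditivity`; closes nothing)

For the OPEN pinned anharmonic chain `pinnedChain ω₂ lam β γ` (all `> 0`) with both baths at `T > 0` write
`c_M(t) = ∫ J·(P_t J) dμ_{M,T}` (`J = Σ_i j_i`) and `S_M(ν) = ∫₀^∞ (1 − e^{−νt}) c_M(t) dt` (the Abel deficit of the `M`-chain).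
(R) says: `∀ ε ∃ ν₀ ∀ ν ∈ (0,ν₀)`, eventually in `N`, `|S_N(ν)| ≤ εN`.

**Theorem (`stub_regularityOfQuasiAdditivity`).** (R) follows from
* (QA) HALVING QUASI-ADDITIVITY: `∃ K, δ ∈ (0,1), ν₁ > 0, N₁` with `|S_N(ν) − S_{⌊N/2⌋}(ν) − S_{N−⌊N/2⌋}(ν)| ≤ K N^{1−δ}` for all
  `ν ∈ (0, ν₁]`, `N ≥ 2N₁` (registered physical stub `stub_abelDeficitQuasiAdditive`), and
* (F) FIXED-`N` ABEL REGULARITY: `S_N(ν) → 0` as `ν ↓ 0` for every `N` (registered analysis stub `stub_fixedNAbelRegularity`;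
  dominated convergence from the landed `c_N ∈ L¹(0,∞)`, p144688),
and in fact with ONE `N₀` for all `ν < ν₀`.

Proof (`regularity_of_halvingDefect`, the PROVED first lemma of the crux idea `zero-mean-dyadic-splice`): strong induction on `N`
down the halving tree with the invariant `|S_N(ν)| ≤ εN − Ψ(N)`, `Ψ(N) = K' N^{1−δ}` a sublinear potential absorbing the defect
(`powerPotential_absorbs`: `K' N^{1−δ} + K N^{1−δ} ≤ K'⌊N/2⌋^{1−δ} + K'⌈N/2⌉^{1−δ}`), down to the finitely many leaves `[N_*, 2N_*)`
where (F) applies.  Why (QA) is a natural cut of (R): in `c_N − c_{⌊N/2⌋} − c_{⌈N/2⌉}` the EXTENSIVE bulk term `(M−1) C(t)` of the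
light-cone splice cancels identically before the common crossing time, so (QA) prices only one junction-minus-two-contacts
correction (early) and three post-crossing signed tails (late; fluctuating hydrodynamics predicts `δ = 1/2`) — no bulk object, no
infinite-volume dynamics, no witness.  Uniformity in `ν ↓ 0` is its content; it fails at the harmonic corner (ballistic tails `≍ N²`).
No named fact is used; nothing here closes the item.
-/

noncomputable section

namespace Summit.AtomisticToContinuum.FouriersLaw.Theorems.UniformAbelianRegularity.ZeroMeanDyadicSplice

open MeasureTheory Set Filter Topology

/-! ## The halving lemma and the power potential -/

/-- **Halving lemma (P1; abstract real analysis).** A family `S N ν` whose HALVING DEFECT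
`|S N ν − S ⌊N/2⌋ ν − S (N − ⌊N/2⌋) ν|` is bounded by `D N` uniformly in `ν ∈ (0, ν₁]` (`N ≥ 2N₁`), with a non-negative
potential `Ψ` that is sublinear (`Ψ N / N → 0`) and absorbs the defect under halving (`Ψ N + D N ≤ Ψ ⌊N/2⌋ + Ψ (N − ⌊N/2⌋)`),
and which is Abel-regular at each fixed `N` (`S N ν → 0` as `ν ↓ 0`), satisfies `∀ ε > 0 ∃ ν₀ > 0 ∃ N₀ ∀ ν ∈ (0, ν₀) ∀ N ≥ N₀,
|S N ν| ≤ ε N` — the (R)-shape with a SINGLE `N₀` for all `ν`.  Strong induction on `N` down the halving tree to the leaves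
`[N_*, 2N_*)`, invariant `|S N ν| ≤ ε N − Ψ N`.  Adapted verbatim (binders curried) from the crux-ideation sketch
`Cruxes/UniformAbelianRegularity/SketchIdeator2.lean` (planner-cruxidea-stmt-AtomisticToContinuum-13416-2-0), where it was proved. [folklore] -/
theorem regularity_of_halvingDefect (S : ℕ → ℝ → ℝ) (D Ψ : ℕ → ℝ) (ν₁ : ℝ) (N₁ : ℕ)
    (hν₁ : 0 < ν₁)
    (hΨ : ∀ N, 0 ≤ Ψ N)
    (hstep : ∀ N : ℕ, 2 * N₁ ≤ N → Ψ N + D N ≤ Ψ (N / 2) + Ψ (N - N / 2))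
    (hΨo : Tendsto (fun N : ℕ => Ψ N / (N : ℝ)) atTop (𝓝 0))
    (hQA : ∀ N : ℕ, 2 * N₁ ≤ N → ∀ ν : ℝ, 0 < ν → ν ≤ ν₁ →
      |S N ν - S (N / 2) ν - S (N - N / 2) ν| ≤ D N)
    (hfix : ∀ N : ℕ, Tendsto (S N) (𝓝[>] 0) (𝓝 0)) :
    ∀ ε : ℝ, 0 < ε → ∃ ν₀ : ℝ, 0 < ν₀ ∧ ∃ N₀ : ℕ, ∀ ν : ℝ, 0 < ν → ν < ν₀ → ∀ N : ℕ, N₀ ≤ N →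
      |S N ν| ≤ ε * N := by
  intro ε hε
  have hε2 : (0:ℝ) < ε / 2 := by linarith
  -- sublinearity of the potential: Ψ N ≤ (ε/2) N beyond Na
  obtain ⟨Na, hNa⟩ := eventually_atTop.1 (hΨo.eventually (Iic_mem_nhds hε2))
  set Ns : ℕ := max Na (max N₁ 1) with hNs_def
  have hNs_Na : Na ≤ Ns := le_max_left _ _
  have hNs_N₁ : N₁ ≤ Ns := (le_max_left _ _).trans (le_max_right _ _)
  have hNs_1 : 1 ≤ Ns := (le_max_right _ _).trans (le_max_right _ _)
  have hΨle : ∀ N : ℕ, Ns ≤ N → Ψ N ≤ ε / 2 * N := by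
    intro N hN
    have hNpos : (0:ℝ) < N := by exact_mod_cast (hNs_1.trans hN)
    have h' : Ψ N / (N:ℝ) ≤ ε / 2 := hNa N (hNs_Na.trans hN)
    rwa [div_le_iff₀ hNpos] at h'
  -- fixed-N Abel regularity on the finite set of leaves [Ns, 2Ns)
  have hleaf : ∀ᶠ ν in 𝓝[>] (0:ℝ), ∀ N ∈ Finset.Ico Ns (2 * Ns), |S N ν| < ε / 2 * N := by
    rw [Filter.eventually_all_finset]
    intro N hN
    have hNpos : (0:ℝ) < N := by
      have : Ns ≤ N := (Finset.mem_Ico.1 hN).1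
      exact_mod_cast (hNs_1.trans this)
    have hr : (0:ℝ) < ε / 2 * N := mul_pos hε2 hNpos
    have := (hfix N).eventually (Metric.ball_mem_nhds (0:ℝ) hr)
    refine this.mono ?_
    intro ν hν
    simpa [Real.dist_eq] using hν
  obtain ⟨u, hu, hsub⟩ := mem_nhdsGT_iff_exists_Ioo_subset.1 hleaf
  refine ⟨min u ν₁, lt_min hu hν₁, Ns, ?_⟩
  intro ν hν0 hνlt
  have hνu : ν < u := hνlt.trans_le (min_le_left _ _)
  have hν₁' : ν ≤ ν₁ := (hνlt.trans_le (min_le_right _ _)).le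
  have hleaf' : ∀ N ∈ Finset.Ico Ns (2 * Ns), |S N ν| < ε / 2 * N := hsub ⟨hν0, hνu⟩
  -- the invariant down the halving tree
  have key : ∀ N : ℕ, Ns ≤ N → |S N ν| ≤ ε * N - Ψ N := by
    intro N
    induction N using Nat.strong_induction_on with
    | _ N ih =>
      intro hN
      by_cases hsmall : N < 2 * Ns
      · -- leaf
        have h1 : |S N ν| < ε / 2 * N := hleaf' N (Finset.mem_Ico.2 ⟨hN, hsmall⟩)
        have h2 : Ψ N ≤ ε / 2 * N := hΨle N hN
        linarith
      · -- split N = N/2 + (N - N/2)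
        push Not at hsmall
        have hN2 : 2 ≤ N := by omega
        have hm : Ns ≤ N / 2 := by omega
        have hm' : Ns ≤ N - N / 2 := by omega
        have hmlt : N / 2 < N := by omega
        have hm'lt : N - N / 2 < N := by omega
        have ihm := ih (N / 2) hmlt hm
        have ihm' := ih (N - N / 2) hm'lt hm'
        have hq := hQA N (by omega) ν hν0 hν₁'
        have hs := hstep N (by omega)
        have hcast : ((N / 2 : ℕ) : ℝ) + ((N - N / 2 : ℕ) : ℝ) = (N : ℝ) := by
          have : N / 2 ≤ N := Nat.div_le_self _ _
          rw [Nat.cast_sub this]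
          ring
        have htri : |S N ν| ≤ |S N ν - S (N / 2) ν - S (N - N / 2) ν| + |S (N / 2) ν| + |S (N - N / 2) ν| := by
          have h3 := abs_add_three (S N ν - S (N / 2) ν - S (N - N / 2) ν) (S (N / 2) ν) (S (N - N / 2) ν)
          have heq : S N ν - S (N / 2) ν - S (N - N / 2) ν + S (N / 2) ν + S (N - N / 2) ν = S N ν := by ring
          rwa [heq] at h3
        calc |S N ν| ≤ D N + (ε * (N / 2 : ℕ) - Ψ (N / 2)) + (ε * (N - N / 2 : ℕ) - Ψ (N - N / 2)) := by
                linarith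
          _ = ε * (((N / 2 : ℕ) : ℝ) + ((N - N / 2 : ℕ) : ℝ)) - (Ψ (N / 2) + Ψ (N - N / 2) - D N) := by ring
          _ ≤ ε * N - Ψ N := by rw [hcast]; linarith
  intro N hN
  have := key N hN
  linarith [hΨ N]

/-- **The power potential absorbs a power defect.** For `K ≥ 0` and `0 < δ < 1` there are `K' ≥ 0` and `N₂` with
`K' N^{1−δ} + K N^{1−δ} ≤ K' ⌊N/2⌋^{1−δ} + K' (N − ⌊N/2⌋)^{1−δ}` for all `N ≥ 2N₂` (take `K' = (1 + 2K)/(2 − 2^{1−δ})` and `N` so large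
that `((N−1)/2)^{1−δ} ≥ K' + K`; uses only `N^{1−δ} ≤ (N−1)^{1−δ} + 1` and `⌊N/2⌋, ⌈N/2⌉ ≥ (N−1)/2`). [folklore] -/
theorem powerPotential_absorbs {K δ : ℝ} (hK : 0 ≤ K) (hδ : 0 < δ) (hδ1 : δ < 1) :
    ∃ K' : ℝ, 0 ≤ K' ∧ ∃ N₂ : ℕ, ∀ N : ℕ, 2 * N₂ ≤ N →
      K' * (N:ℝ) ^ (1 - δ) + K * (N:ℝ) ^ (1 - δ) ≤
        K' * ((N / 2 : ℕ) : ℝ) ^ (1 - δ) + K' * ((N - N / 2 : ℕ) : ℝ) ^ (1 - δ) := by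
  set s : ℝ := 1 - δ with hs_def
  have hs0 : 0 < s := by simp only [hs_def]; linarith
  have hs1 : s < 1 := by simp only [hs_def]; linarith
  have h2s : (2:ℝ) ^ s < 2 := by
    have h := Real.rpow_lt_rpow_of_exponent_lt (show (1:ℝ) < 2 by norm_num) hs1
    rwa [Real.rpow_one] at h
  have h2s0 : 0 < (2:ℝ) ^ s := Real.rpow_pos_of_pos two_pos _
  set K' : ℝ := (1 + 2 * K) / (2 - 2 ^ s) with hK'_def
  have hden : 0 < 2 - (2:ℝ) ^ s := by linarith
  have hK'0 : 0 ≤ K' := div_nonneg (by linarith) hden.le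
  have hK'eq : K' * (2 - 2 ^ s) = 1 + 2 * K := div_mul_cancel₀ _ hden.ne'
  -- `(K' + K) 2^s ≤ 2K' − 1`
  have hkey : (K' + K) * 2 ^ s ≤ 2 * K' - 1 := by nlinarith
  -- threshold
  set x₀ : ℝ := (K' + K + 1) ^ (1 / s) with hx₀_def
  have hx₀0 : 0 ≤ x₀ := Real.rpow_nonneg (by linarith) _
  refine ⟨K', hK'0, ⌈x₀⌉₊ + 1, fun N hN => ?_⟩
  have hN2 : 2 ≤ N := by omega
  have hNr : (2:ℝ) ≤ N := by exact_mod_cast hN2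
  -- the halves
  have ha : ((N:ℝ) - 1) / 2 ≤ ((N / 2 : ℕ) : ℝ) := by
    have h1 : N - 1 ≤ 2 * (N / 2) := by omega
    have h2 : ((N - 1 : ℕ) : ℝ) ≤ ((2 * (N / 2) : ℕ) : ℝ) := by exact_mod_cast h1
    rw [Nat.cast_sub (by omega), Nat.cast_mul] at h2
    push_cast at h2
    linarith
  have hb : ((N:ℝ) - 1) / 2 ≤ ((N - N / 2 : ℕ) : ℝ) := by
    have h1 : N - 1 ≤ 2 * (N - N / 2) := by omega
    have h2 : ((N - 1 : ℕ) : ℝ) ≤ ((2 * (N - N / 2) : ℕ) : ℝ) := by exact_mod_cast h1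
    rw [Nat.cast_sub (by omega), Nat.cast_mul] at h2
    push_cast at h2
    linarith
  have hm0 : 0 ≤ ((N:ℝ) - 1) / 2 := by linarith
  -- `x₀ ≤ (N−1)/2`
  have hx₀N : x₀ ≤ ((N:ℝ) - 1) / 2 := by
    have h1 : x₀ ≤ ⌈x₀⌉₊ := Nat.le_ceil _
    have h2 : ((2 * (⌈x₀⌉₊ + 1) : ℕ) : ℝ) ≤ N := by exact_mod_cast hN
    push_cast at h2
    linarith
  -- `t = ((N−1)/2)^s ≥ K' + K`
  set t : ℝ := (((N:ℝ) - 1) / 2) ^ s with ht_def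
  have ht0 : 0 ≤ t := Real.rpow_nonneg hm0 _
  have htK : K' + K ≤ t := by
    calc K' + K ≤ K' + K + 1 := by linarith
      _ = x₀ ^ s := by
          rw [hx₀_def, ← Real.rpow_mul (by linarith), one_div, inv_mul_cancel₀ hs0.ne', Real.rpow_one]
      _ ≤ t := Real.rpow_le_rpow hx₀0 hx₀N hs0.le
  -- `N^s ≤ 2^s t + 1`
  have hNs : (N:ℝ) ^ s ≤ 2 ^ s * t + 1 := by
    have hN1 : (0:ℝ) ≤ (N:ℝ) - 1 := by linarith
    have hsub : ((N:ℝ) - 1 + 1) ^ s ≤ ((N:ℝ) - 1) ^ s + (1:ℝ) ^ s := by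
      obtain ⟨x, hx⟩ : ∃ x : NNReal, (x:ℝ) = (N:ℝ) - 1 := ⟨⟨(N:ℝ) - 1, hN1⟩, rfl⟩
      rw [← hx]
      exact_mod_cast NNReal.rpow_add_le_add_rpow x 1 hs0.le hs1.le
    rw [sub_add_cancel, Real.one_rpow] at hsub
    have hmul : ((N:ℝ) - 1) ^ s = 2 ^ s * t := by
      rw [ht_def, ← Real.mul_rpow (by norm_num) hm0]
      congr 1
      ring
    linarith
  -- lower bounds for the halves
  have has : t ≤ ((N / 2 : ℕ) : ℝ) ^ s := Real.rpow_le_rpow hm0 ha hs0.le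
  have hbs : t ≤ ((N - N / 2 : ℕ) : ℝ) ^ s := Real.rpow_le_rpow hm0 hb hs0.le
  -- combine
  have hNs0 : 0 ≤ (N:ℝ) ^ s := Real.rpow_nonneg (by linarith) _
  calc K' * (N:ℝ) ^ s + K * (N:ℝ) ^ s = (K' + K) * (N:ℝ) ^ s := by ring
    _ ≤ (K' + K) * (2 ^ s * t + 1) := by gcongr
    _ = ((K' + K) * 2 ^ s) * t + (K' + K) := by ring
    _ ≤ (2 * K' - 1) * t + (K' + K) := by gcongr
    _ ≤ 2 * K' * t := by nlinarith
    _ = K' * t + K' * t := by ring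
    _ ≤ K' * ((N / 2 : ℕ) : ℝ) ^ s + K' * ((N - N / 2 : ℕ) : ℝ) ^ s := by gcongr

/-! ## The glue: (R) from halving quasi-additivity and fixed-`N` Abel regularity -/

/-- **Registered glue stub `stub_regularityOfQuasiAdditivity` of line `Sketch` (composition B, crux stmt-AtomisticToContinuum-13416).**
Halving quasi-additivity of the Abel deficit with a power defect `K N^{1−δ}` uniformly in `ν ∈ (0, ν₁]` (stub
`stub_abelDeficitQuasiAdditive`) and fixed-`N` Abel regularity `S_N(ν) → 0` (`ν ↓ 0`) (stub `stub_fixedNAbelRegularity`) imply (R) — the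
`EmbeddedDrudeMourre` copy of `UniformAbelianRegularity`, `rfl`-equal to the `StaticAbelianSqueeze` one — with, in fact, one `N₀` for
all `ν < ν₀` (`regularity_of_halvingDefect` with the power potential of `powerPotential_absorbs`).  No bulk object occurs anywhere. [folklore] -/
theorem stub_regularityOfQuasiAdditivity :
    (∀ ω₂ lam β γ : ℝ, 0 < ω₂ → 0 < lam → 0 < β → 0 < γ → ∀ T : ℝ, 0 < T →
      ∃ (K δ ν₁ : ℝ) (N₁ : ℕ), 0 < δ ∧ δ < 1 ∧ 0 < ν₁ ∧ ∀ ν : ℝ, 0 < ν → ν ≤ ν₁ → ∀ N : ℕ, 2 * N₁ ≤ N →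
        let c : ℕ → ℝ → ℝ := fun M t => ∫ z, (∑ i : Fin M, (Literature.MathematicalPhysics.KineticTheory.HeatConduction.pinnedChain ω₂ lam β γ).bondCurrent M i z) * (∫ y, (∑ i : Fin M, (Literature.MathematicalPhysics.KineticTheory.HeatConduction.pinnedChain ω₂ lam β γ).bondCurrent M i y) ∂((Literature.MathematicalPhysics.KineticTheory.HeatConduction.pinnedChain ω₂ lam β γ).transitionKernel M T T t.toNNReal z)) ∂((Literature.MathematicalPhysics.KineticTheory.HeatConduction.pinnedChain ω₂ lam β γ).gibbsMeasure M T);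
        let S : ℕ → ℝ := fun M => ∫ t in Set.Ioi (0:ℝ), (1 - Real.exp (-(ν * t))) * c M t;
        |S N - S (N / 2) - S (N - N / 2)| ≤ K * (N:ℝ) ^ (1 - δ)) →
    (∀ ω₂ lam β γ : ℝ, 0 < ω₂ → 0 < lam → 0 < β → 0 < γ → ∀ T : ℝ, 0 < T → ∀ N : ℕ, let J : Literature.MathematicalPhysics.KineticTheory.HeatConduction.PhaseSpace N → ℝ := fun z => ∑ i : Fin N, (Literature.MathematicalPhysics.KineticTheory.HeatConduction.pinnedChain ω₂ lam β γ).bondCurrent N i z;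
      Filter.Tendsto (fun ν : ℝ => ∫ t in Set.Ioi (0:ℝ), (1 - Real.exp (-(ν * t))) * ∫ z, J z * (∫ y, J y ∂((Literature.MathematicalPhysics.KineticTheory.HeatConduction.pinnedChain ω₂ lam β γ).transitionKernel N T T t.toNNReal z)) ∂((Literature.MathematicalPhysics.KineticTheory.HeatConduction.pinnedChain ω₂ lam β γ).gibbsMeasure N T)) (nhdsWithin (0:ℝ) (Set.Ioi 0)) (nhds 0)) →
    _root_.Summit.AtomisticToContinuum.FouriersLaw.Theses.EmbeddedDrudeMourre.UniformAbelianRegularity := by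
  intro hQ hF ω₂ lam β γ hω hl hβ hγ T hT ε hε
  obtain ⟨K, δ, ν₁, N₁, hδ, hδ1, hν₁, hq⟩ := hQ ω₂ lam β γ hω hl hβ hγ T hT
  set P := Literature.MathematicalPhysics.KineticTheory.HeatConduction.pinnedChain ω₂ lam β γ with hP_def
  -- the family `S M ν = ∫₀^∞ (1 − e^{−νt}) c_M(t) dt`
  set c : ℕ → ℝ → ℝ := fun M t => ∫ z, (∑ i : Fin M, P.bondCurrent M i z) *
      (∫ y, (∑ i : Fin M, P.bondCurrent M i y) ∂(P.transitionKernel M T T t.toNNReal z)) ∂(P.gibbsMeasure M T) with hc_def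
  set S : ℕ → ℝ → ℝ := fun M ν => ∫ t in Ioi (0:ℝ), (1 - Real.exp (-(ν * t))) * c M t with hS_def
  have hK0 : 0 ≤ max K 0 := le_max_right _ _
  obtain ⟨K', hK'0, N₂, hstep'⟩ := powerPotential_absorbs hK0 hδ hδ1
  have key := regularity_of_halvingDefect S (fun N => max K 0 * (N:ℝ) ^ (1 - δ)) (fun N => K' * (N:ℝ) ^ (1 - δ))
    ν₁ (max N₁ N₂) hν₁ (fun N => mul_nonneg hK'0 (Real.rpow_nonneg (Nat.cast_nonneg _) _)) ?_ ?_ ?_ ?_ ε hε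
  · obtain ⟨ν₀, hν₀, N₀, hkey⟩ := key
    refine ⟨ν₀, hν₀, fun ν hν hνlt => ⟨N₀, fun N hN => ?_⟩⟩
    exact hkey ν hν hνlt N hN
  · -- the potential absorbs the defect
    intro N hN
    have h2 : 2 * N₂ ≤ N := le_trans (Nat.mul_le_mul_left 2 (le_max_right _ _)) hN
    have h := hstep' N h2
    linarith
  · -- sublinearity `K' N^{1−δ} / N → 0`
    have h1 : Tendsto (fun N : ℕ => K' * ((N:ℝ) ^ (-δ))) atTop (𝓝 (K' * 0)) :=
      ((tendsto_rpow_neg_atTop hδ).comp tendsto_natCast_atTop_atTop).const_mul K'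
    rw [mul_zero] at h1
    refine h1.congr' ?_
    filter_upwards [eventually_ge_atTop 1] with N hN
    have hN0 : (0:ℝ) < N := by exact_mod_cast hN
    rw [mul_div_assoc, ← Real.rpow_sub_one hN0.ne']
    congr 2
    ring
  · -- the quasi-additivity stub
    intro N hN ν hν hνle
    have h1 : 2 * N₁ ≤ N := le_trans (Nat.mul_le_mul_left 2 (le_max_left _ _)) hN
    have h : |S N ν - S (N / 2) ν - S (N - N / 2) ν| ≤ K * (N:ℝ) ^ (1 - δ) := hq ν hν hνle N h1
    exact h.trans (mul_le_mul_of_nonneg_right (le_max_left _ _) (Real.rpow_nonneg (Nat.cast_nonneg _) _))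
  · -- fixed-`N` Abel regularity stub
    intro N
    exact hF ω₂ lam β γ hω hl hβ hγ T hT N


end Summit.AtomisticToContinuum.FouriersLaw.Theorems.UniformAbelianRegularity.ZeroMeanDyadicSplice

end
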